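import Literature.AlgebraicGeometry.Motives.HodgeLieRankLowerBound
import Literature.AlgebraicGeometry.Motives.HodgeThetaSubalgebraRealPlacesSl2
import Literature.AlgebraicGeometry.Motives.HodgeStructureK3TypeAdjointProofs
import Literature.AlgebraicGeometry.Motives.HodgeThetaAnnihilatorTimesNonCMCurve
import HarnessLib

/-!
# Twisted `Θ`-rigidity of a weight-one Hodge structure of rank four with complex multiplication by a quartic field:
# `Θ − c·y₀ ∈ K ⊗ ℂ` with `c² ∈ ℚ`, `y₀ ∈ 𝔥`, `K ⊆ 𝔥` rational forces `K = 𝔥`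
# (the `H¹` of a SIMPLE CM abelian surface never resonates with a factor whose skew centre is an imaginary quadratic line —
# Moonen–Zarhin 1999 (5.6): «`Hg(Y₁) = U_{F₁}` is a `ℚ`-simple torus of rank `2`, so it is not isogenous to a subtorus of `U_k`»)

Family `hodge`, layer `Literature/AlgebraicGeometry/Motives`; THEOREMS ONLY (no definition, no named fact).  Written for the cell
`pub-hodgecm2` (COR-CM), seat `b27` gen 49 (count-neutral Mumford–Tate-rank ladder), as the arithmetic input of
`Motives/HodgeLieTimesCMSummand` §6 for the cell «simple CM surface × abelian variety with imaginary quadratic `End⁰`».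

SETTING.  `H` a polarized (`ψ`) effective Hodge structure of weight `1` on `V` with `dim_ℚ V = 4` whose algebra of Hodge endomorphisms
`F = End_Hdg(V)` is COMMUTATIVE, of `ℚ`-dimension `4`, with inverses (`F` is a quartic field — for `V = H¹(S(ℂ), ℚ)`: `S` is a simple
abelian surface of CM type, Riemann: `End_Hdg(H¹S) ≅ End⁰(S)`), and with `dim_ℚ 𝔥(H) = 2` (`dim MT(H¹S) = 3`).  Then `𝔥 = 𝔥(H) ⊆ F`
(`hodgeLie_le_endAlg_of_finrank_hodgeLie_le_two`) consists of `ψ`-skew elements, `Θ ∈ 𝔥_ℂ`, `Θ² = 1` (§1).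

RESULTS.
* §2 **`RankFourCM.not_theta_eq_smul_baseChange`** — `Θ ≠ c · w_ℂ` for every RATIONAL `w ∈ 𝔥` and `c ∈ ℂ`.  Proof: otherwise every
  rational operator commuting with `w` is a Hodge endomorphism (`ThetaSubalgebra.mem_endAlg_of_forall_commute` with `𝔤 = ℚw`), so the
  commutant `C(w)` lies in the commutative `F`; but `w² = q'·1` is rational (`tr`), `K = ℚ + ℚw ⊊ F`, and for `y ∈ F ∖ K`, `0 ≠ v ∈ V` the
  vectors `v, wv, yv, wyv` form a basis of `V` (the orbit map `F → V`, `f ↦ f v`, is injective since `F` has inverses) in which the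
  projection `P` onto `ℚv ⊕ ℚwv` along `ℚyv ⊕ ℚwyv` commutes with `w` but not with `y` (`P(yv) = 0 ≠ yv = y(Pv)`).
* §3 **`RankFourCM.hodgeLie_le_of_theta_sub_smul_mem_spanC`** (TWISTED RIGIDITY) — if `Θ − c·(y₀)_ℂ ∈ K_ℂ` for some `y₀ ∈ 𝔥`, a rational
  subspace `K ⊆ 𝔥` and `c ∈ ℂ` with `c² = q ∈ ℚ`, then `𝔥 ⊆ K`.  Proof: if `K ⊊ 𝔥` then `K ⊆ ℚk₁` and `Θ = c y₀ + b k₁` (`b ∈ ℂ`); the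
  cases `k₁ = 0`, `y₀ ∈ ℚk₁`, `c = 0` are §2.  Otherwise `y₀, k₁` span `𝔥`, `q ≠ 0`, and `Θ² = 1` gives, with `z = cb`,
  `(∗) q² a + 2qz s + z² m = q·1` in `F ⊗ ℂ` for the `ψ`-SYMMETRIC elements `a = y₀², s = y₀k₁, m = k₁²` of `F`.  The symmetric part
  `Sym = F ∩ {ψ-self-adjoint}` is a subalgebra with `Sym ∩ 𝔥 = 0`, so `dim Sym ≤ 2`: `Sym = ℚ1` or `Sym = ℚ1 ⊕ ℚδ`.  If `a, s ∈ ℚ1` then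
  `k₁ = (s/a) y₀ ∈ ℚy₀` — excluded.  So write `a = a₁ + a₂δ`, `s = b₁ + b₂δ`, `m = c₁ + c₂δ`; reading `(∗)` in the `ℂ`-basis `1, δ_ℂ`:
  `q²a₁ + 2qzb₁ + z²c₁ = q` and `q²a₂ + 2qzb₂ + z²c₂ = 0`.  If the minor `c₂b₁ − c₁b₂ ≠ 0`, elimination of `z²` gives `z ∈ ℚ`, whence
  `Θ = c⁻¹(q y₀ + z k₁)_ℂ` — §2 again.  If it vanishes, all `2×2` minors of `(c₁, b₁, a₁ − 1/q)` and `(c₂, b₂, a₂)` vanish, so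
  `a = 1/q + a₂δ'`, `s = b₂δ'`, `m = c₂δ'` for `δ' = δ + μ`; then `s² = am` in the field `F` reads `(b₂² − a₂c₂)δ'² = (c₂/q)δ'` with
  `δ'² = e₁ + e₂δ'`, forcing `c₂ = 0` (so `k₁² = 0`, `k₁ = 0`) or `δ' ∈ ℚ` — contradiction.  No use of the sign of `q` or of a real
  structure is made; `q = 0` is the plain rigidity of §2.
AV reading (`CorCM/MumfordTateRankCMSurfaceTimesTypeIV`): with `c = tr(Θ_A φ^*)/tr((φ^*)²)`, `c² = −(2p−g)²/(g²d) ∈ ℚ` for `φ² = −d` on `H¹A`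
(multiplicities `(p, g−p)`), the resonance of `HodgeLieTimesCMSummand` never occurs against `H¹S`: `dim MT(H¹(A × S)) = dim MT(H¹A) + 2`.

## References
* [MoonenZarhin1999LowDim] B. Moonen, Yu. G. Zarhin, *Hodge classes on abelian varieties of low dimension*, Math. Ann. 315 (1999), §2 (2.2)
  (type IV(2,1): «`End⁰(X) = F` a quartic CM-field not containing an imaginary quadratic subfield», «`MT(X) = U_F`»), §3 Lemma (3.6)–(3.7),
  (5.6) [corpus: paper:arxiv-math_9901113 pp. 5, 7, 10]. [cite: MoonenZarhin1999LowDim, §3 Lemma (3.6) and (5.6)]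
* [Deligne1982HodgeCycles] P. Deligne, *Hodge cycles on abelian varieties*, LNM 900 (1982), I §3 Prop. 3.4, Prop. 3.6.
  [cite: Deligne1982HodgeCycles, I §3 Prop. 3.4]
* [Shimura1998] G. Shimura, *Abelian Varieties with Complex Multiplication and Modular Functions* (1998), §8.4 Example (2) (quartic CM types:
  primitive iff the field is not biquadratic). [cite: Shimura1998, §8.4 Example (2)]
-/

noncomputable section

open scoped TensorProduct

namespace Literature.AlgebraicGeometry.Motives

namespace HodgeStructure

universe u

variable {V : Type u} [AddCommGroup V] [Module ℚ V] [Module.Finite ℚ V] [HodgeTensorFacts.{u, u}] {n : ℤ}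
  (H : HodgeStructure V n) (hn : n = 1) (heff : H.IsEffective) (ψ : H.Polarization)
  {Θ : Module.End ℂ (ℂ ⊗[ℚ] V)} (hΘ : ∀ p, ∀ x ∈ H.piece p (n - p), Θ x = ((2 * p - n : ℤ) : ℂ) • x)

/-! ## §1 Generalities: `Θ² = 1` in effective weight one; base change of independent operators; rational operators with scalar square -/

omit [Module.Finite ℚ V] [HodgeTensorFacts.{u, u}] in
include hn heff hΘ in
/-- **`Θ² = 1` for an effective Hodge structure of weight one**: `Θ = ±1` on `V^{1,0}`, `V^{0,1}`, and the other pieces vanish.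
[cite: Deligne1982HodgeCycles, I §3 Prop. 3.4] -/
theorem RankFourCM.theta_mul_theta_eq_one : Θ * Θ = 1 := by
  subst hn
  refine LinearMap.ext fun x => ?_
  have hx : x ∈ ⨆ p : ℤ, H.piece p (1 - p) := by rw [iSup_piece_eq_top_holds H]; exact Submodule.mem_top
  induction hx using Submodule.iSup_induction' with
  | mem p x hx =>
    rw [Module.End.mul_apply, Module.End.one_apply, hΘ p x hx, map_smul, hΘ p x hx, smul_smul]
    by_cases hx0 : x = 0
    · rw [hx0, smul_zero]
    · have hne : H.piece p (1 - p) ≠ ⊥ := by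
        intro h
        rw [h, Submodule.mem_bot] at hx
        exact hx0 hx
      obtain ⟨hp0, hq0⟩ := heff p (1 - p) hne
      have hp : p = 0 ∨ p = 1 := by omega
      rcases hp with rfl | rfl <;> norm_num
  | zero => simp
  | add x y _ _ hx hy =>
    rw [Module.End.mul_apply, Module.End.one_apply] at hx hy ⊢
    rw [map_add, map_add, hx, hy]

omit [HodgeTensorFacts.{u, u}] in
/-- `ℚ`-independent rational operators have `ℂ`-independent complexifications (`dim_ℂ 𝔤_ℂ = dim_ℚ 𝔤`, `finrank_spanC_eq`).
[cite: Deligne1982HodgeCycles, I §3 (proof of Prop. 3.4)] -/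
private theorem linearIndependent_baseChange_of_linearIndependent_rf {d : ℕ} {u : Fin d → Module.End ℚ V}
    (hu : LinearIndependent ℚ u) : LinearIndependent ℂ fun j => (u j).baseChange ℂ := by
  rw [linearIndependent_iff_card_eq_finrank_span, Fintype.card_fin]
  have hspan : Submodule.span ℂ (Set.range fun j => (u j).baseChange ℂ) = spanC (Submodule.span ℚ (Set.range u)) := by
    apply le_antisymm
    · rw [Submodule.span_le]
      rintro _ ⟨j, rfl⟩
      exact baseChange_mem_spanC (Submodule.subset_span ⟨j, rfl⟩)
    · rw [spanC, Submodule.span_le]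
      rintro _ ⟨Z, hZ, rfl⟩
      have hZ' : Z ∈ Submodule.span ℚ (Set.range u) := hZ
      change Z.baseChange ℂ ∈ Submodule.span ℂ (Set.range fun j => (u j).baseChange ℂ)
      clear hZ
      induction hZ' using Submodule.span_induction with
      | mem _ h =>
        obtain ⟨j, rfl⟩ := h
        exact Submodule.subset_span ⟨j, rfl⟩
      | zero => rw [LinearMap.baseChange_zero]; exact Submodule.zero_mem _
      | add Z Z' _ _ hZ hZ' => rw [LinearMap.baseChange_add]; exact Submodule.add_mem _ hZ hZ'
      | smul q Z _ hZ =>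
        rw [LinearMap.baseChange_smul, ← Rat.cast_smul_eq_qsmul ℂ q]; exact Submodule.smul_mem _ _ hZ
  rw [Set.finrank, hspan, finrank_spanC_eq, finrank_span_eq_card hu, Fintype.card_fin]

omit [Module.Finite ℚ V] [HodgeTensorFacts.{u, u}] in
/-- Base change of a rational multiple: `(c • T)_ℂ = c • T_ℂ`. [folklore] -/
private theorem baseChange_ratCast_smul_rf (c : ℚ) (T : Module.End ℚ V) :
    (c • T).baseChange ℂ = (c : ℂ) • T.baseChange ℂ := by
  refine TensorProduct.AlgebraTensorModule.ext fun z v => ?_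
  rw [LinearMap.baseChange_tmul, LinearMap.smul_apply, LinearMap.smul_apply, LinearMap.baseChange_tmul,
    TensorProduct.smul_tmul', ← TensorProduct.smul_tmul, Rat.smul_def, smul_eq_mul]

omit [HodgeTensorFacts.{u, u}] in
/-- **A rational operator whose complexification is a complex scalar is a rational scalar**: `X_ℂ = c·1` ⟹ `X = q·1` with
`(q : ℂ) = c` (take traces: `dim V · c = tr(X) ∈ ℚ`), for `V ≠ 0`. [folklore] -/
private theorem exists_eq_smul_one_of_baseChange_eq_smul [Nontrivial V] {X : Module.End ℚ V} {c : ℂ}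
    (hX : X.baseChange ℂ = c • (1 : Module.End ℂ (ℂ ⊗[ℚ] V))) : ∃ q : ℚ, (q : ℂ) = c ∧ X = q • 1 := by
  classical
  have hd : (Module.finrank ℚ V : ℂ) ≠ 0 := by exact_mod_cast Module.finrank_pos.ne'
  have htr : ((LinearMap.trace ℚ V X : ℚ) : ℂ) = c * Module.finrank ℚ V := by
    have h := LinearMap.trace_baseChange X ℂ
    rw [hX, map_smul, LinearMap.trace_one, Module.finrank_baseChange, smul_eq_mul, eq_ratCast] at h
    rw [← h]
  refine ⟨LinearMap.trace ℚ V X / Module.finrank ℚ V, ?_, ?_⟩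
  · rw [Rat.cast_div, Rat.cast_natCast, htr, mul_div_assoc, div_self hd, mul_one]
  · have h0 : (X - (LinearMap.trace ℚ V X / Module.finrank ℚ V) • 1).baseChange ℂ = 0 := by
      rw [LinearMap.baseChange_sub, baseChange_ratCast_smul_rf, LinearMap.baseChange_one, hX, Rat.cast_div, Rat.cast_natCast, htr,
        mul_div_assoc, div_self hd, mul_one, sub_self]
    have hmem : (X - (LinearMap.trace ℚ V X / Module.finrank ℚ V) • 1) ∈ (⊥ : Submodule ℚ (Module.End ℚ V)) := by
      refine mem_of_baseChange_mem_spanC ⊥ ?_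
      rw [h0]
      exact Submodule.zero_mem _
    rw [Submodule.mem_bot, sub_eq_zero] at hmem
    exact hmem

/-! ## §2 `Θ ∉ ℂ · w_ℂ` for rational `w ∈ 𝔥` when `End_Hdg` is a commutative algebra of dimension `4` with inverses -/

section Field

variable (hV : Module.finrank ℚ V = 4)
  (hcomm : ∀ a ∈ H.endAlg, ∀ b ∈ H.endAlg, a * b = b * a)
  (hinv : ∀ a ∈ H.endAlg, a ≠ 0 → ∃ b ∈ H.endAlg, b * a = 1)
  (hE4 : Module.finrank ℚ (Subalgebra.toSubmodule H.endAlg) = 4)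

omit [Module.Finite ℚ V] [HodgeTensorFacts.{u, u}] in
include hV in
/-- `V ≠ 0`. [folklore] -/
private theorem nontrivial_of_finrank_eq_four : Nontrivial V :=
  Module.nontrivial_of_finrank_pos (R := ℚ) (by omega)

omit [Module.Finite ℚ V] [HodgeTensorFacts.{u, u}] in
include hinv in
/-- **The orbit map `F → V`, `f ↦ f v`, is injective for `v ≠ 0`** when `F = End_Hdg` has inverses. [folklore] -/
private theorem eq_zero_of_apply_eq_zero {f : Module.End ℚ V} (hf : f ∈ H.endAlg) {v : V} (hv : v ≠ 0) (hfv : f v = 0) : f = 0 := by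
  by_contra hf0
  obtain ⟨g, -, hg⟩ := hinv f hf hf0
  apply hv
  have h := congrArg g hfv
  rwa [map_zero, ← Module.End.mul_apply, hg, Module.End.one_apply] at h

include hn heff ψ hΘ hV hcomm hinv hE4 in
/-- **`Θ ≠ c · w_ℂ` for a rational `w ∈ 𝔥(H)`** when `F = End_Hdg(V)` is commutative of dimension `4` with inverses (`dim V = 4`, weight
one, effective, polarized).  Otherwise: `w ≠ 0`, `c ≠ 0` (`Θ² = 1 ≠ 0`), `w ∉ ℚ1` (`1 ∉ 𝔥`, `id_notMem_hodgeLie`); every rational `u`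
with `uw = wu` commutes with `𝔤 = ℚw ∋_ℂ Θ`, hence is a Hodge endomorphism (`ThetaSubalgebra.mem_endAlg_of_forall_commute`): `C(w) ⊆ F`;
in particular `w ∈ F` and `w² = q'·1` (`w_ℂ² = c⁻²`).  Pick `y ∈ F` outside `K = ℚ1 + ℚw` (`dim F = 4 > 2`) and `v ≠ 0`: then
`v, wv, yv, w(yv)` is a basis of `V` (a vanishing combination is `f v = 0` with `f = α + βw + (γ + δw)y ∈ F`, so `f = 0`, so
`(γ + δw) y ∈ K`, so `γ + δw = 0` — multiply by `γ − δw` — so all coefficients vanish), and the projection `P` onto `ℚv ⊕ ℚwv` along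
`ℚyv ⊕ ℚw(yv)` commutes with `w` (`w² = q'`), hence `P ∈ F`, hence `Py = yP`; but `P(yv) = 0` while `y(Pv) = yv ≠ 0`.  (For `V = H¹S`:
«`Hg(S)` is not contained in a one-dimensional rational subtorus `ℚw` of `U_F`» — the CM type of a simple CM surface is primitive.)
[cite: MoonenZarhin1999LowDim, §2 (2.2) and (5.6)] [cite: Deligne1982HodgeCycles, I §3 Prop. 3.4] -/
theorem RankFourCM.not_theta_eq_smul_baseChange {w : Module.End ℚ V} (hw : w ∈ H.hodgeLie) (c : ℂ)
    (hΘw : Θ = c • w.baseChange ℂ) : False := by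
  classical
  haveI : Nontrivial V := nontrivial_of_finrank_eq_four hV
  haveI : Nontrivial (ℂ ⊗[ℚ] V) := Module.nontrivial_of_finrank_pos (R := ℂ) (by rw [Module.finrank_baseChange, hV]; norm_num)
  have hΘΘ := RankFourCM.theta_mul_theta_eq_one H hn heff hΘ
  -- `c ≠ 0`, `w ≠ 0`
  have hc : c ≠ 0 := by
    rintro rfl
    rw [zero_smul] at hΘw
    rw [hΘw, mul_zero] at hΘΘ
    exact zero_ne_one hΘΘ
  have hw0 : w ≠ 0 := by
    rintro rfl
    rw [LinearMap.baseChange_zero, smul_zero] at hΘw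
    rw [hΘw, mul_zero] at hΘΘ
    exact zero_ne_one hΘΘ
  -- `w ∉ ℚ1`
  have hw1 : ∀ r : ℚ, w ≠ r • 1 := by
    intro r hr
    rcases eq_or_ne r 0 with rfl | hr0
    · rw [zero_smul] at hr; exact hw0 hr
    · have h1 : (LinearMap.id : Module.End ℚ V) ∈ H.hodgeLie := by
        have h := Submodule.smul_mem H.hodgeLie r⁻¹ hw
        rwa [hr, smul_smul, inv_mul_cancel₀ hr0, one_smul] at h
      exact id_notMem_hodgeLie H ψ h1
  -- `C(w) ⊆ F`
  have hΘ𝔤 : Θ ∈ spanC (ℚ ∙ w) := by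
    rw [hΘw]
    exact Submodule.smul_mem _ _ (baseChange_mem_spanC (Submodule.mem_span_singleton_self w))
  have hC : ∀ u : Module.End ℚ V, u * w = w * u → u ∈ H.endAlg := fun u hu =>
    ThetaSubalgebra.mem_endAlg_of_forall_commute H (ℚ ∙ w) hΘ hΘ𝔤 fun X hX => by
      obtain ⟨r, rfl⟩ := Submodule.mem_span_singleton.1 hX
      rw [mul_smul_comm, smul_mul_assoc, hu]
  have hwF : w ∈ H.endAlg := hC w rfl
  -- `w² = q' · 1`
  have hw2C : (w * w).baseChange ℂ = (c⁻¹ * c⁻¹) • (1 : Module.End ℂ (ℂ ⊗[ℚ] V)) := by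
    have h : (c • w.baseChange ℂ) * (c • w.baseChange ℂ) = 1 := by rw [← hΘw]; exact hΘΘ
    rw [smul_mul_smul_comm, ← LinearMap.baseChange_mul] at h
    rw [← h, smul_smul, ← mul_assoc, mul_assoc c⁻¹, inv_mul_cancel₀ hc, mul_one, inv_mul_cancel₀ hc, one_smul]
  obtain ⟨q', -, hw2⟩ := exists_eq_smul_one_of_baseChange_eq_smul hw2C
  -- `y ∈ F` outside `K = span {1, w}`
  have hK2 : Module.finrank ℚ (Submodule.span ℚ (Set.range ![(1 : Module.End ℚ V), w])) ≤ 2 :=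
    (finrank_range_le_card (R := ℚ) ![(1 : Module.End ℚ V), w]).trans (by rw [Fintype.card_fin])
  obtain ⟨y, hyF, hyK⟩ : ∃ y ∈ H.endAlg, y ∉ Submodule.span ℚ (Set.range ![(1 : Module.End ℚ V), w]) := by
    by_contra hno
    push Not at hno
    have hle : Subalgebra.toSubmodule H.endAlg ≤ Submodule.span ℚ (Set.range ![(1 : Module.End ℚ V), w]) :=
      fun a ha => hno a ((Subalgebra.mem_toSubmodule _).1 ha)
    have h := Submodule.finrank_mono hle
    omega
  -- membership in `K` in coordinates
  have hmemK : ∀ α β : ℚ, α • (1 : Module.End ℚ V) + β • w ∈ Submodule.span ℚ (Set.range ![(1 : Module.End ℚ V), w]) := fun α β =>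
    Submodule.add_mem _ (Submodule.smul_mem _ _ (Submodule.subset_span ⟨0, rfl⟩))
      (Submodule.smul_mem _ _ (Submodule.subset_span ⟨1, rfl⟩))
  -- `1, w` are independent
  have h1w : ∀ γ δ : ℚ, γ • (1 : Module.End ℚ V) + δ • w = 0 → γ = 0 ∧ δ = 0 := by
    intro γ δ h0
    by_cases hδ : δ = 0
    · rw [hδ, zero_smul, add_zero] at h0
      exact ⟨(smul_eq_zero.1 h0).resolve_right one_ne_zero, hδ⟩
    · exfalso
      apply hw1 (-(γ / δ))
      have h1 : δ • w = -(γ • (1 : Module.End ℚ V)) := eq_neg_of_add_eq_zero_right h0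
      calc w = δ⁻¹ • (δ • w) := by rw [smul_smul, inv_mul_cancel₀ hδ, one_smul]
        _ = -(γ / δ) • 1 := by rw [h1, smul_neg, smul_smul, neg_smul, div_eq_inv_mul]
  -- the key helper: `(γ + δw) y ∈ K` forces `γ = δ = 0`
  have hkey : ∀ γ δ α β : ℚ, (γ • (1 : Module.End ℚ V) + δ • w) * y = α • 1 + β • w → γ = 0 ∧ δ = 0 := by
    intro γ δ α β h
    have hF1 : (γ • (1 : Module.End ℚ V) - δ • w) * (γ • 1 + δ • w) = (γ * γ - δ * δ * q') • 1 := by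
      rw [sub_mul, mul_add, mul_add, smul_mul_smul_comm, smul_mul_smul_comm, smul_mul_smul_comm, smul_mul_smul_comm,
        one_mul, mul_one, one_mul, hw2, smul_smul, mul_comm δ γ, sub_smul]
      abel
    have hF2 : (γ • (1 : Module.End ℚ V) - δ • w) * (α • 1 + β • w) = (γ * α - δ * β * q') • 1 + (γ * β - δ * α) • w := by
      rw [sub_mul, mul_add, mul_add, smul_mul_smul_comm, smul_mul_smul_comm, smul_mul_smul_comm, smul_mul_smul_comm,
        one_mul, mul_one, one_mul, hw2, smul_smul, sub_smul, sub_smul]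
      abel
    have hNy : (γ * γ - δ * δ * q') • y = (γ * α - δ * β * q') • (1 : Module.End ℚ V) + (γ * β - δ * α) • w := by
      rw [← hF2, ← h, ← mul_assoc, hF1, smul_mul_assoc, one_mul]
    by_cases hN0 : γ * γ - δ * δ * q' = 0
    · by_cases ha : γ • (1 : Module.End ℚ V) + δ • w = 0
      · exact h1w γ δ ha
      · exfalso
        have haF : γ • (1 : Module.End ℚ V) + δ • w ∈ H.endAlg :=
          Subalgebra.add_mem _ (Subalgebra.smul_mem _ (Subalgebra.one_mem _) _) (Subalgebra.smul_mem _ hwF _)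
        obtain ⟨g, hgF, hg⟩ := hinv _ haF ha
        have hag : (γ • (1 : Module.End ℚ V) + δ • w) * g = 1 := by rw [hcomm _ haF g hgF]; exact hg
        have hbar : γ • (1 : Module.End ℚ V) - δ • w = 0 := by
          calc γ • (1 : Module.End ℚ V) - δ • w = (γ • 1 - δ • w) * ((γ • 1 + δ • w) * g) := by rw [hag, mul_one]
            _ = 0 := by rw [← mul_assoc, hF1, hN0, zero_smul, zero_mul]
        have h' := h1w γ (-δ) (by rw [neg_smul, ← sub_eq_add_neg]; exact hbar)
        apply ha
        rw [h'.1, neg_eq_zero.1 h'.2, zero_smul, zero_smul, add_zero]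
    · exfalso
      apply hyK
      have hmem : (γ * γ - δ * δ * q') • y ∈ Submodule.span ℚ (Set.range ![(1 : Module.End ℚ V), w]) := by
        rw [hNy]; exact hmemK _ _
      have h2 := Submodule.smul_mem _ (γ * γ - δ * δ * q')⁻¹ hmem
      rwa [smul_smul, inv_mul_cancel₀ hN0, one_smul] at h2
  -- the basis `v, wv, yv, w(yv)`
  obtain ⟨v, hv⟩ := exists_ne (0 : V)
  have hyF' : (1 : Module.End ℚ V) ∈ H.endAlg := Subalgebra.one_mem _
  set b : Fin 4 → V := ![v, w v, y v, w (y v)] with hbdef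
  have hb0 : b 0 = v := rfl
  have hb1 : b 1 = w v := rfl
  have hb2 : b 2 = y v := rfl
  have hb3 : b 3 = w (y v) := rfl
  have hb : LinearIndependent ℚ b := by
    rw [Fintype.linearIndependent_iff]
    intro g hg
    have hsum : ∑ i, g i • b i = (g 0 • (1 : Module.End ℚ V) + g 1 • w + (g 2 • 1 + g 3 • w) * y) v := by
      rw [Fin.sum_univ_four, hb0, hb1, hb2, hb3]
      simp only [LinearMap.add_apply, LinearMap.smul_apply, Module.End.mul_apply, Module.End.one_apply]
      abel
    have hfF : g 0 • (1 : Module.End ℚ V) + g 1 • w + (g 2 • 1 + g 3 • w) * y ∈ H.endAlg :=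
      Subalgebra.add_mem _ (Subalgebra.add_mem _ (Subalgebra.smul_mem _ hyF' _) (Subalgebra.smul_mem _ hwF _))
        (Subalgebra.mul_mem _ (Subalgebra.add_mem _ (Subalgebra.smul_mem _ hyF' _) (Subalgebra.smul_mem _ hwF _)) hyF)
    have hf0 := eq_zero_of_apply_eq_zero H hinv hfF hv (by rw [← hsum]; exact hg)
    have h23 : (g 2 • (1 : Module.End ℚ V) + g 3 • w) * y = (-g 0) • 1 + (-g 1) • w := by
      rw [neg_smul, neg_smul, ← neg_add, eq_neg_iff_add_eq_zero, add_comm]; exact hf0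
    obtain ⟨h2, h3⟩ := hkey _ _ _ _ h23
    have h01 : g 0 • (1 : Module.End ℚ V) + g 1 • w = 0 := by
      rw [h2, h3, zero_smul, zero_smul, add_zero, zero_mul, add_zero] at hf0; exact hf0
    obtain ⟨h0, h1⟩ := h1w _ _ h01
    intro i
    fin_cases i <;> assumption
  have hcard : Fintype.card (Fin 4) = Module.finrank ℚ V := by rw [Fintype.card_fin, hV]
  let B := basisOfLinearIndependentOfCardEqFinrank hb hcard
  have hB : ∀ i, B i = b i := fun i => by rw [coe_basisOfLinearIndependentOfCardEqFinrank]
  -- the projection onto `ℚv ⊕ ℚwv` along `ℚyv ⊕ ℚw(yv)`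
  let P : Module.End ℚ V := B.constr ℚ (![v, w v, 0, 0] : Fin 4 → V)
  have hP0 : P (b 0) = v := by rw [← hB]; exact B.constr_basis ℚ _ 0
  have hP1 : P (b 1) = w v := by rw [← hB]; exact B.constr_basis ℚ _ 1
  have hP2 : P (b 2) = 0 := by rw [← hB]; exact B.constr_basis ℚ _ 2
  have hP3 : P (b 3) = 0 := by rw [← hB]; exact B.constr_basis ℚ _ 3
  have hww : ∀ x, w (w x) = q' • x := fun x => by
    rw [← Module.End.mul_apply, hw2, LinearMap.smul_apply, Module.End.one_apply]
  have hPw : P * w = w * P := by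
    refine B.ext fun i => ?_
    rw [Module.End.mul_apply, Module.End.mul_apply, hB]
    fin_cases i
    · change P (w (b 0)) = w (P (b 0))
      rw [hP0, hb0]
      change P (b 1) = w v
      exact hP1
    · change P (w (b 1)) = w (P (b 1))
      rw [hP1, hb1, hww, map_smul]
      change q' • P (b 0) = q' • v
      rw [hP0]
    · change P (w (b 2)) = w (P (b 2))
      rw [hP2, map_zero, hb2]
      change P (b 3) = 0
      exact hP3
    · change P (w (b 3)) = w (P (b 3))
      rw [hP3, map_zero, hb3, hww, map_smul]
      change q' • P (b 2) = 0
      rw [hP2, smul_zero]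
  have hPF : P ∈ H.endAlg := hC P hPw
  -- `P y = y P` fails at `v`
  have hPy := hcomm P hPF y hyF
  have hyv : y v = 0 := by
    have h := LinearMap.congr_fun hPy v
    simp only [Module.End.mul_apply] at h
    change P (b 2) = y (P (b 0)) at h
    rw [hP2, hP0] at h
    exact h.symm
  have hy0 : y = 0 := eq_zero_of_apply_eq_zero H hinv hyF hv hyv
  exact hyK (hy0 ▸ Submodule.zero_mem _)

omit [Module.Finite ℚ V] [HodgeTensorFacts.{u, u}] in
/-- `(ℚ z)_ℂ ≤ ℂ z_ℂ`. [folklore] -/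
private theorem spanC_span_singleton_le_rf (z : Module.End ℚ V) : spanC (ℚ ∙ z) ≤ ℂ ∙ z.baseChange ℂ := by
  change Submodule.span ℂ _ ≤ _
  rw [Submodule.span_le]
  rintro _ ⟨X, hX, rfl⟩
  obtain ⟨q, rfl⟩ := Submodule.mem_span_singleton.1 hX
  change (q • z).baseChange ℂ ∈ ℂ ∙ z.baseChange ℂ
  rw [baseChange_ratCast_smul_rf]
  exact Submodule.smul_mem _ _ (Submodule.mem_span_singleton_self _)

omit [Module.Finite ℚ V] [HodgeTensorFacts.{u, u}] in
/-- `(x • 1 + y • δ)_ℂ = x • 1 + y • δ_ℂ`. [folklore] -/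
private theorem baseChange_smul_one_add_smul (x y : ℚ) (δ : Module.End ℚ V) :
    (x • (1 : Module.End ℚ V) + y • δ).baseChange ℂ = (x : ℂ) • (1 : Module.End ℂ (ℂ ⊗[ℚ] V)) + (y : ℂ) • δ.baseChange ℂ := by
  rw [LinearMap.baseChange_add, baseChange_ratCast_smul_rf, baseChange_ratCast_smul_rf, LinearMap.baseChange_one]

/-! ## §3 Twisted rigidity: `Θ − c·(y₀)_ℂ ∈ K_ℂ` with `c² ∈ ℚ` forces `𝔥 ⊆ K` -/

include hn heff ψ hΘ hV hcomm hinv hE4 in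
/-- **Twisted `Θ`-rigidity of a rank-four weight-one Hodge structure with CM by a quartic field.**  Let `dim_ℚ V = 4`, `H` effective of
weight one, polarized, with `F = End_Hdg(V)` commutative of dimension `4` with inverses, and `dim 𝔥(H) = 2` (the `H¹` of a SIMPLE CM
abelian surface).  If `Θ − c·(y₀)_ℂ ∈ K_ℂ` for some `y₀ ∈ 𝔥(H)`, a rational subspace `K ⊆ 𝔥(H)` and `c ∈ ℂ` with `c² = q ∈ ℚ`, then
`𝔥(H) ⊆ K`.  (With `c = tr(Θ₁φ₁)/tr(φ₁²)` for a factor `H₁` with skew centre `ℚφ₁`, `φ₁² = −d`: the resonance of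
`HodgeLieTimesCMSummand` along a PROPER `K` never happens — Moonen–Zarhin (5.6): «`U_{F₁}` is not isogenous to a subtorus of the
one-dimensional centre `U_k`»; for `c = 0` this is the plain statement that `Θ` lies in no proper rational subspace of `𝔥 = Lie U_F`,
i.e. that the CM type is primitive.)  Proof in the module docstring (§2 for the degenerate cases; `Θ² = 1` read in the symmetric
subalgebra `Sym = ℚ1 ⊕ ℚδ` of `F`, elimination of `z = cb`, and `s² = am` in the field `F`).
[cite: MoonenZarhin1999LowDim, §3 Lemma (3.6)–(3.7) and (5.6)] [cite: Shimura1998, §8.4 Example (2)] -/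
theorem RankFourCM.hodgeLie_le_of_theta_sub_smul_mem_spanC (h𝔥2 : Module.finrank ℚ H.hodgeLie = 2) {y₀ : Module.End ℚ V}
    (hy₀ : y₀ ∈ H.hodgeLie) (K : Submodule ℚ (Module.End ℚ V)) (hK : K ≤ H.hodgeLie) {c : ℂ} {q : ℚ} (hcq : c * c = (q : ℂ))
    (hmem : Θ - c • y₀.baseChange ℂ ∈ spanC K) : H.hodgeLie ≤ K := by
  classical
  haveI : Nontrivial V := nontrivial_of_finrank_eq_four hV
  by_contra hnot
  have hA : ∀ {w : Module.End ℚ V}, w ∈ H.hodgeLie → ∀ c' : ℂ, Θ = c' • w.baseChange ℂ → False := fun hw c' h =>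
    RankFourCM.not_theta_eq_smul_baseChange H hn heff ψ hΘ hV hcomm hinv hE4 hw c' h
  -- `K ⊆ ℚ k₁` for some `k₁ ∈ 𝔥`
  have hlt : K < H.hodgeLie := lt_of_le_of_ne hK fun h => hnot h.ge
  have hK1 : Module.finrank ℚ K ≤ 1 := by
    have h := Submodule.finrank_lt_finrank_of_lt hlt
    omega
  obtain ⟨k₁, hk₁𝔥, hKle⟩ : ∃ k₁ ∈ H.hodgeLie, K ≤ ℚ ∙ k₁ := by
    obtain ⟨v, hv⟩ := finrank_le_one_iff.1 hK1
    refine ⟨(v : Module.End ℚ V), hK v.2, fun x hx => ?_⟩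
    obtain ⟨r, hr⟩ := hv ⟨x, hx⟩
    rw [Submodule.mem_span_singleton]
    exact ⟨r, by simpa using congrArg Subtype.val hr⟩
  obtain ⟨b, hb⟩ : ∃ b : ℂ, Θ - c • y₀.baseChange ℂ = b • k₁.baseChange ℂ := by
    have h := (spanC_mono hKle).trans (spanC_span_singleton_le_rf k₁) hmem
    obtain ⟨b, hb⟩ := Submodule.mem_span_singleton.1 h
    exact ⟨b, hb.symm⟩
  have hΘeq : Θ = c • y₀.baseChange ℂ + b • k₁.baseChange ℂ := by rw [← hb, add_sub_cancel]
  -- degenerate cases: `k₁ = 0`, `y₀ ∈ ℚ k₁`, `c = 0`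
  by_cases hk₁0 : k₁ = 0
  · rw [hk₁0, LinearMap.baseChange_zero, smul_zero, add_zero] at hΘeq
    exact hA hy₀ c hΘeq
  by_cases hy₀k : y₀ ∈ ℚ ∙ k₁
  · obtain ⟨r, rfl⟩ := Submodule.mem_span_singleton.1 hy₀k
    rw [baseChange_ratCast_smul_rf, smul_smul, ← add_smul] at hΘeq
    exact hA hk₁𝔥 _ hΘeq
  by_cases hc0 : c = 0
  · rw [hc0, zero_smul, zero_add] at hΘeq
    exact hA hk₁𝔥 b hΘeq
  have hq0 : q ≠ 0 := by
    rintro rfl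
    rw [Rat.cast_zero, mul_self_eq_zero] at hcq
    exact hc0 hcq
  -- `y₀, k₁` independent, in `F`
  have hpair : ∀ s t : ℚ, s • y₀ + t • k₁ = 0 → s = 0 ∧ t = 0 := by
    intro s t h
    by_cases hs : s = 0
    · rw [hs, zero_smul, zero_add] at h
      exact ⟨hs, (smul_eq_zero.1 h).resolve_right hk₁0⟩
    · exfalso
      apply hy₀k
      rw [Submodule.mem_span_singleton]
      refine ⟨-(t / s), ?_⟩
      have h1 : s • y₀ = -(t • k₁) := eq_neg_of_add_eq_zero_left h
      calc -(t / s) • k₁ = s⁻¹ • (-(t • k₁)) := by rw [smul_neg, smul_smul, neg_smul, div_eq_inv_mul]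
        _ = y₀ := by rw [← h1, smul_smul, inv_mul_cancel₀ hs, one_smul]
  have hy₀0 : y₀ ≠ 0 := by
    intro h
    have := (hpair 1 0 (by rw [h, smul_zero, zero_smul, add_zero])).1
    exact one_ne_zero this
  have h𝔥F : H.hodgeLie ≤ Subalgebra.toSubmodule H.endAlg := hodgeLie_le_endAlg_of_finrank_hodgeLie_le_two H h𝔥2.le
  have hy₀F : y₀ ∈ H.endAlg := (Subalgebra.mem_toSubmodule _).1 (h𝔥F hy₀)
  have hk₁F : k₁ ∈ H.endAlg := (Subalgebra.mem_toSubmodule _).1 (h𝔥F hk₁𝔥)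
  have hdom : ∀ f ∈ H.endAlg, ∀ g : Module.End ℚ V, f * g = 0 → f = 0 ∨ g = 0 := by
    intro f hf g hfg
    by_cases hf0 : f = 0
    · exact Or.inl hf0
    · obtain ⟨f', -, hf'⟩ := hinv f hf hf0
      right
      calc g = f' * f * g := by rw [hf', one_mul]
        _ = 0 := by rw [mul_assoc, hfg, mul_zero]
  -- `Θ² = 1` read with `z = c b`: `q² a + 2 q z s + z² m = q · 1`
  set a := y₀ * y₀ with ha
  set s := y₀ * k₁ with hs
  set m := k₁ * k₁ with hm
  have hks : k₁ * y₀ = s := (hcomm _ hk₁F _ hy₀F).trans hs.symm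
  set z : ℂ := c * b with hz
  have hEE : ((q * q : ℚ) : ℂ) • a.baseChange ℂ + (2 * (q : ℂ) * z) • s.baseChange ℂ + (z * z) • m.baseChange ℂ =
      (q : ℂ) • (1 : Module.End ℂ (ℂ ⊗[ℚ] V)) := by
    have hΘΘ := RankFourCM.theta_mul_theta_eq_one H hn heff hΘ
    rw [hΘeq, add_mul, mul_add, mul_add, smul_mul_smul_comm, smul_mul_smul_comm, smul_mul_smul_comm, smul_mul_smul_comm,
      ← LinearMap.baseChange_mul, ← LinearMap.baseChange_mul, ← LinearMap.baseChange_mul, ← LinearMap.baseChange_mul, hks, hcq] at hΘΘ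
    rw [← ha, ← hs, ← hm] at hΘΘ
    have h := congrArg (fun T => (q : ℂ) • T) hΘΘ
    simp only [smul_add, smul_smul] at h
    rw [Rat.cast_mul, hz, ← h]
    have hcc : (q : ℂ) * (b * b) = c * b * (c * b) := by rw [← hcq]; ring
    have hbc : (q : ℂ) * (b * c) = (q : ℂ) * (c * b) := by ring
    rw [hcc, hbc]
    module
  -- the symmetric part `Sym = F ∩ {ψ-self-adjoint}`: contains `1, a, s, m`, meets `𝔥` trivially, `dim ≤ 2`
  set Sym : Submodule ℚ (Module.End ℚ V) := Subalgebra.toSubmodule H.endAlg ⊓ ψ.form.selfAdjointSubmodule with hSymdef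
  have hmemSym : ∀ f, f ∈ Sym ↔ f ∈ H.endAlg ∧ ∀ u v, ψ.form (f u) v = ψ.form u (f v) := fun f => by
    rw [hSymdef, Submodule.mem_inf, Subalgebra.mem_toSubmodule, LinearMap.mem_selfAdjointSubmodule]
    rfl
  have hskew : ∀ {X}, X ∈ H.hodgeLie → ∀ u v, ψ.form (X u) v = -ψ.form u (X v) := fun hX u v =>
    eq_neg_of_add_eq_zero_left (form_apply_add_eq_zero_of_mem_hodgeLie ψ hX u v)
  have hprodSym : ∀ {X Y}, X ∈ H.hodgeLie → Y ∈ H.hodgeLie → X * Y ∈ Sym := by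
    intro X Y hX hY
    have hXF : X ∈ H.endAlg := (Subalgebra.mem_toSubmodule _).1 (h𝔥F hX)
    have hYF : Y ∈ H.endAlg := (Subalgebra.mem_toSubmodule _).1 (h𝔥F hY)
    refine (hmemSym _).2 ⟨Subalgebra.mul_mem _ hXF hYF, fun u v => ?_⟩
    rw [Module.End.mul_apply, hskew hX, hskew hY, neg_neg, ← Module.End.mul_apply, hcomm _ hYF _ hXF]
  have h1Sym : (1 : Module.End ℚ V) ∈ Sym := (hmemSym _).2 ⟨Subalgebra.one_mem _, fun u v => rfl⟩
  have haSym : a ∈ Sym := hprodSym hy₀ hy₀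
  have hsSym : s ∈ Sym := hprodSym hy₀ hk₁𝔥
  have hmSym : m ∈ Sym := hprodSym hk₁𝔥 hk₁𝔥
  have hmulSym : ∀ {f g}, f ∈ Sym → g ∈ Sym → f * g ∈ Sym := by
    intro f g hf hg
    obtain ⟨hfF, hfψ⟩ := (hmemSym _).1 hf
    obtain ⟨hgF, hgψ⟩ := (hmemSym _).1 hg
    refine (hmemSym _).2 ⟨Subalgebra.mul_mem _ hfF hgF, fun u v => ?_⟩
    rw [Module.End.mul_apply, hfψ, hgψ, ← Module.End.mul_apply, hcomm _ hgF _ hfF]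
  have hSym𝔥 : Sym ⊓ H.hodgeLie = ⊥ := by
    rw [Submodule.eq_bot_iff]
    intro f hf
    obtain ⟨hfS, hf𝔥⟩ := Submodule.mem_inf.1 hf
    obtain ⟨-, hfψ⟩ := (hmemSym _).1 hfS
    refine LinearMap.ext fun v => ψ.nondegenerate.2 (f v) fun u => ?_
    have h1 := hfψ u v
    have h2 := hskew hf𝔥 u v
    have h3 : ψ.form u (f v) = -ψ.form u (f v) := h1.symm.trans h2
    linarith
  have hSym2 : Module.finrank ℚ Sym ≤ 2 := by
    have hsup : Sym ⊔ H.hodgeLie ≤ Subalgebra.toSubmodule H.endAlg := sup_le inf_le_left h𝔥F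
    have h1 := Submodule.finrank_mono hsup
    have h2 := Submodule.finrank_sup_add_finrank_inf_eq Sym H.hodgeLie
    rw [hSym𝔥, finrank_bot, add_zero] at h2
    omega
  -- Case I: `a, s ∈ ℚ1` is impossible
  have hcaseI : ∀ a₁ b₁ : ℚ, a = a₁ • 1 → s = b₁ • 1 → False := by
    intro a₁ b₁ ha₁ hb₁
    have h1 : y₀ * s = a₁ • k₁ := by rw [hs, ← mul_assoc, ← ha, ha₁, smul_mul_assoc, one_mul]
    have h2 : y₀ * s = b₁ • y₀ := by rw [hb₁, mul_smul_comm, mul_one]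
    have h3 : (-b₁) • y₀ + a₁ • k₁ = 0 := by rw [neg_smul, ← h2, h1, neg_add_cancel]
    obtain ⟨-, ha0⟩ := hpair _ _ h3
    rw [ha0, zero_smul] at ha₁
    rcases hdom y₀ hy₀F y₀ ha₁ with h | h <;> exact hy₀0 h
  by_cases hSym1 : Sym ≤ ℚ ∙ (1 : Module.End ℚ V)
  · obtain ⟨a₁, ha₁⟩ := Submodule.mem_span_singleton.1 (hSym1 haSym)
    obtain ⟨b₁, hb₁⟩ := Submodule.mem_span_singleton.1 (hSym1 hsSym)
    exact hcaseI a₁ b₁ ha₁.symm hb₁.symm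
  -- Case II: `Sym = ℚ1 ⊕ ℚδ`
  obtain ⟨δ, hδSym, hδ1⟩ : ∃ δ ∈ Sym, δ ∉ ℚ ∙ (1 : Module.End ℚ V) := by
    by_contra hno
    push Not at hno
    exact hSym1 fun f hf => hno f hf
  have hpair1δ : ∀ x y : ℚ, x • (1 : Module.End ℚ V) + y • δ = 0 → x = 0 ∧ y = 0 := by
    intro x y h
    by_cases hy : y = 0
    · rw [hy, zero_smul, add_zero] at h
      exact ⟨(smul_eq_zero.1 h).resolve_right one_ne_zero, hy⟩
    · exfalso
      apply hδ1
      rw [Submodule.mem_span_singleton]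
      refine ⟨-(x / y), ?_⟩
      have h1 : y • δ = -(x • (1 : Module.End ℚ V)) := eq_neg_of_add_eq_zero_right h
      calc -(x / y) • (1 : Module.End ℚ V) = y⁻¹ • (-(x • 1)) := by rw [smul_neg, smul_smul, neg_smul, div_eq_inv_mul]
        _ = δ := by rw [← h1, smul_smul, inv_mul_cancel₀ hy, one_smul]
  have hli1δ : LinearIndependent ℚ ![(1 : Module.End ℚ V), δ] := LinearIndependent.pair_iff.2 hpair1δ
  have hSymle : Sym ≤ Submodule.span ℚ (Set.range ![(1 : Module.End ℚ V), δ]) := by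
    have hle : Submodule.span ℚ (Set.range ![(1 : Module.End ℚ V), δ]) ≤ Sym := by
      rw [Submodule.span_le]
      rintro _ ⟨i, rfl⟩
      fin_cases i
      · exact h1Sym
      · exact hδSym
    have heq := Submodule.eq_of_le_of_finrank_le hle (by rw [finrank_span_eq_card hli1δ, Fintype.card_fin]; exact hSym2)
    exact heq.ge
  have hcoord : ∀ {f}, f ∈ Sym → ∃ x y : ℚ, f = x • 1 + y • δ := by
    intro f hf
    obtain ⟨g, hg⟩ := (Submodule.mem_span_range_iff_exists_fun ℚ).1 (hSymle hf)
    refine ⟨g 0, g 1, ?_⟩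
    rw [← hg, Fin.sum_univ_two]
    rfl
  obtain ⟨a₁, a₂, haδ⟩ := hcoord haSym
  obtain ⟨b₁, b₂, hsδ⟩ := hcoord hsSym
  obtain ⟨c₁, c₂, hmδ⟩ := hcoord hmSym
  -- `(EE)` in the `ℂ`-basis `1, δ_ℂ`
  have hliC : LinearIndependent ℂ ![(1 : Module.End ℂ (ℂ ⊗[ℚ] V)), δ.baseChange ℂ] := by
    have h := linearIndependent_baseChange_of_linearIndependent_rf hli1δ
    have hfun : (fun j => ((![(1 : Module.End ℚ V), δ] : Fin 2 → Module.End ℚ V) j).baseChange ℂ) =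
        ![(1 : Module.End ℂ (ℂ ⊗[ℚ] V)), δ.baseChange ℂ] := by
      funext j
      fin_cases j
      · change LinearMap.baseChange ℂ (1 : Module.End ℚ V) = (1 : Module.End ℂ (ℂ ⊗[ℚ] V))
        exact LinearMap.baseChange_one ℚ V
      · rfl
    rwa [hfun] at h
  have hcoef : ((q : ℂ) * q * a₁ + 2 * q * z * b₁ + z * z * c₁ - q) • (1 : Module.End ℂ (ℂ ⊗[ℚ] V)) +
      ((q : ℂ) * q * a₂ + 2 * q * z * b₂ + z * z * c₂) • δ.baseChange ℂ = 0 := by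
    rw [haδ, hsδ, hmδ, baseChange_smul_one_add_smul, baseChange_smul_one_add_smul, baseChange_smul_one_add_smul, Rat.cast_mul] at hEE
    rw [← sub_eq_zero] at hEE
    rw [← hEE]
    module
  obtain ⟨hE1, hEδ⟩ := LinearIndependent.pair_iff.1 hliC _ _ hcoef
  -- the minor `M = c₂ b₁ − c₁ b₂`
  by_cases hM : c₂ * b₁ - c₁ * b₂ = 0
  swap
  · -- `M ≠ 0`: `z` is rational, so `Θ ∈ ℂ (q y₀ + r k₁)_ℂ`
    set r : ℚ := (c₂ - q * (c₂ * a₁ - c₁ * a₂)) / (2 * (c₂ * b₁ - c₁ * b₂)) with hr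
    have hqC : (q : ℂ) ≠ 0 := by exact_mod_cast hq0
    have hMC0 : ((c₂ : ℂ) * b₁ - c₁ * b₂) ≠ 0 := by
      intro h
      apply hM
      exact_mod_cast h
    have hlin : (q : ℂ) * (2 * ((c₂ : ℂ) * b₁ - c₁ * b₂) * z) = (q : ℂ) * (c₂ - q * (c₂ * a₁ - c₁ * a₂)) := by
      linear_combination (c₂ : ℂ) * hE1 - (c₁ : ℂ) * hEδ
    have h2 : 2 * ((c₂ : ℂ) * b₁ - c₁ * b₂) * z = (c₂ : ℂ) - q * (c₂ * a₁ - c₁ * a₂) := mul_left_cancel₀ hqC hlin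
    have hzr : z = (r : ℂ) := by
      rw [hr]
      push_cast
      rw [eq_div_iff (mul_ne_zero two_ne_zero hMC0)]
      linear_combination h2
    have hbr : b = c⁻¹ * r := by rw [← hzr, hz, ← mul_assoc, inv_mul_cancel₀ hc0, one_mul]
    apply hA (Submodule.add_mem _ (Submodule.smul_mem _ q hy₀) (Submodule.smul_mem _ r hk₁𝔥)) c⁻¹
    rw [hΘeq, hbr, LinearMap.baseChange_add, baseChange_ratCast_smul_rf, baseChange_ratCast_smul_rf, smul_add, smul_smul, smul_smul,
      ← hcq, ← mul_assoc, inv_mul_cancel₀ hc0, one_mul]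
  · -- `M = 0`: all minors vanish
    have hM' : c₂ * b₁ = c₁ * b₂ := sub_eq_zero.1 hM
    have hMC : (c₂ : ℂ) * b₁ - c₁ * b₂ = 0 := by exact_mod_cast hM
    have hM1 : q * (c₂ * a₁ - c₁ * a₂) = c₂ := by
      have h : (q : ℂ) * (q * (c₂ * a₁ - c₁ * a₂) - c₂) = 0 := by
        linear_combination (c₂ : ℂ) * hE1 - (c₁ : ℂ) * hEδ + (-(2 : ℂ) * q * z) * hMC
      have h' := (mul_eq_zero.1 h).resolve_left (by exact_mod_cast hq0)
      have h'' : ((q * (c₂ * a₁ - c₁ * a₂) - c₂ : ℚ) : ℂ) = 0 := by push_cast; exact h'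
      exact sub_eq_zero.1 (by exact_mod_cast h'')
    have hM2 : q * (b₂ * a₁ - b₁ * a₂) = b₂ := by
      have h : (q : ℂ) * (q * (b₂ * a₁ - b₁ * a₂) - b₂) = 0 := by
        linear_combination (b₂ : ℂ) * hE1 - (b₁ : ℂ) * hEδ + (z * z) * hMC
      have h' := (mul_eq_zero.1 h).resolve_left (by exact_mod_cast hq0)
      have h'' : ((q * (b₂ * a₁ - b₁ * a₂) - b₂ : ℚ) : ℂ) = 0 := by push_cast; exact h'
      exact sub_eq_zero.1 (by exact_mod_cast h'')
    by_cases hb₂ : b₂ = 0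
    · -- then `s ∈ ℚ1`: either `s = 0` (so `y₀ k₁ = 0`) or `a₂ = 0` (Case I)
      have hba : b₁ * a₂ = 0 := by
        have h : q * (b₁ * a₂) = 0 := by
          rw [hb₂] at hM2
          linear_combination -hM2
        exact (mul_eq_zero.1 h).resolve_left hq0
      rw [hb₂, zero_smul, add_zero] at hsδ
      rcases eq_or_ne b₁ 0 with hb₁ | hb₁
      · rw [hb₁, zero_smul] at hsδ
        rcases hdom y₀ hy₀F k₁ (by rw [← hs]; exact hsδ) with h | h
        · exact hy₀0 h
        · exact hk₁0 h
      · have ha₂ : a₂ = 0 := (mul_eq_zero.1 hba).resolve_left hb₁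
        rw [ha₂, zero_smul, add_zero] at haδ
        exact hcaseI a₁ b₁ haδ hsδ
    · -- `b₂ ≠ 0`: shift `δ' = δ + μ`, `μ = b₁ / b₂`
      set μ : ℚ := b₁ / b₂ with hμ
      set δ' : Module.End ℚ V := δ + μ • 1 with hδ'
      have hb₁μ : b₁ = μ * b₂ := by rw [hμ, div_mul_cancel₀ b₁ hb₂]
      have hc₁μ : c₁ = μ * c₂ := by
        rw [hμ, div_mul_eq_mul_div, eq_div_iff hb₂]
        linear_combination -hM'
      have ha₁μ : a₁ = q⁻¹ + μ * a₂ := by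
        rw [hμ]
        field_simp
        linear_combination hM2
      have hsδ' : s = b₂ • δ' := by rw [hsδ, hδ', hb₁μ, smul_add, smul_smul, mul_comm b₂ μ, add_comm]
      have hmδ' : m = c₂ • δ' := by rw [hmδ, hδ', hc₁μ, smul_add, smul_smul, mul_comm c₂ μ, add_comm]
      have haδ' : a = q⁻¹ • 1 + a₂ • δ' := by rw [haδ, hδ', ha₁μ, smul_add, smul_smul, add_smul, mul_comm a₂ μ]; abel
      have hδ'1 : ∀ t : ℚ, δ' ≠ t • 1 := by
        intro t ht
        apply hδ1
        rw [Submodule.mem_span_singleton]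
        exact ⟨t - μ, by rw [sub_smul, ← ht, hδ', add_sub_cancel_right]⟩
      have hδ'F : δ' ∈ H.endAlg := Subalgebra.add_mem _ ((hmemSym _).1 hδSym).1 (Subalgebra.smul_mem _ (Subalgebra.one_mem _) _)
      clear_value δ'
      -- `s² = a m` in `F`
      have hsq : s * s = a * m := by
        calc s * s = y₀ * (k₁ * y₀) * k₁ := by rw [hs]; noncomm_ring
          _ = a * m := by rw [hks, hs, ha, hm]; noncomm_ring
      rw [hsδ', hmδ', haδ', smul_mul_smul_comm, add_mul, smul_mul_smul_comm, smul_mul_smul_comm, one_mul] at hsq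
      -- `(b₂² − a₂ c₂) δ'² = q⁻¹ c₂ δ'`
      have hkeyδ : (b₂ * b₂ - a₂ * c₂) • (δ' * δ') = (q⁻¹ * c₂) • δ' := by rw [sub_smul, hsq]; abel
      by_cases hco : b₂ * b₂ - a₂ * c₂ = 0
      · rw [hco, zero_smul] at hkeyδ
        have hc₂ : c₂ = 0 := by
          rcases smul_eq_zero.1 hkeyδ.symm with h | h
          · exact (mul_eq_zero.1 h).resolve_left (inv_ne_zero hq0)
          · exact absurd h (by simpa using hδ'1 0)
        rw [hc₂, zero_smul] at hmδ'
        rcases hdom k₁ hk₁F k₁ (hm ▸ hmδ') with h | h <;> exact hk₁0 h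
      · have hδδ : δ' * (δ' - ((q⁻¹ * c₂) / (b₂ * b₂ - a₂ * c₂)) • 1) = 0 := by
          rw [mul_sub, mul_smul_comm, mul_one, div_eq_inv_mul, ← smul_smul, ← hkeyδ, smul_smul, inv_mul_cancel₀ hco, one_smul, sub_self]
        rcases hdom δ' hδ'F _ hδδ with h | h
        · exact hδ'1 0 (by rw [h, zero_smul])
        · exact hδ'1 _ (sub_eq_zero.1 h)

end Field

end HodgeStructure

end Literature.AlgebraicGeometry.Motives

end
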